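import Literature.Algebra.Homology.DiscreteRepStandardResolutionNaturality
import Literature.Algebra.Homology.DiscreteRepOpenSubgroupCoindRes
import Literature.Algebra.Homology.ExtOfAcyclicResolutionFunctorialitySquares
import Mathlib.RepresentationTheory.Homological.ContCohomology.Functoriality
import HarnessLib

/-!
# The comparison `Extⁿ_{C_Γ}(k, X) ≅ Hⁿ_cont(Γ, X)` commutes with restriction to an open subgroup

Topic `Algebra/Homology`; namespace `Literature.Algebra.Homology.DiscreteRep`.  Sequel of
`DiscreteRepStandardResolution(Naturality)`, `DiscreteRepOpenSubgroup(CoindRes)` and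
`ExtOfAcyclicResolutionFunctoriality(Squares)`; no named fact, no `sorry`.

Let `Γ` be a compact topological group, `U ≤ Γ` an open subgroup of finite index (compact), `k` a
commutative ring and `X` a topologically discrete `k`-linear `Γ`-representation with open
stabilisers (`hX`).  Write `Φ_X : Extⁿ_{C_Γ}(k, X) ≃+ Hⁿ_cont(Γ, X)` for the comparison of
`DiscreteRepStandardResolution` and `Res : C_Γ ⥤ C_U` for `DiscreteRepOpenSubgroup.resD` (exact).
**Theorem (`extTrivAddEquivContinuousCohomology_res`).**  For `x ∈ Extⁿ_{C_Γ}(k, X)`,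

  `Hⁿ(res) (Φ_X x) = Φ_{Res X} (Res x)`,

where `Hⁿ(res) : Hⁿ_cont(Γ, X) → Hⁿ_cont(U, Res X)` is Mathlib's
`ContinuousCohomology.map (U ↪ Γ) (𝟙 (Res X))` and `Res x` is `Ext.mapExactFunctor Res x`.
This is the `Ext`-side meaning of the restriction map ([Harari2020, §1.5 Definition 1.33; §4.3 (2)]) used by
the class-formation axioms; the corestriction is its Shapiro-adjoint (`DiscreteRepOpenSubgroupCanonical`).

Proof: `Res` of Mathlib's standard complex of `X` over `Γ` is an exact (`Res` exact),
`Ext_{C_U}(k, –)`-acyclic (`DiscreteRepOpenSubgroupCoindRes`) resolution of `Res X` in `C_U`, mapping to the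
standard complex of `Res X` over `U` by Mathlib's `ContinuousCohomology.resolutionMap (U ↪ Γ) (𝟙)`
(`stdComplexResMap`); the squares of `ExtOfAcyclicResolutionFunctorialitySquares` (for the exact
functor `Res`) and of `ExtOfAcyclicResolutionNaturality` (for that chain map) are glued to Mathlib's
`cochainsMap` under the identification `Ext⁰(k, C(Γ, …)) = C(Γ, …)^Γ` (`extComplexIso_res`).

## References
* D. Harari, *Galois Cohomology and Class Field Theory*, Springer (2020), §4.3 Remark 4.24 and item (2),
  §1.5 Definition 1.33 (restriction); Prop. 16.18 (compatibility of the pairings with Shapiro / Cores).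
  [Harari2020]
* C. A. Weibel, *An introduction to homological algebra* (1994), §2.4, Thm. 2.7.6. [Weibel1994]
-/

-- CITATION-FIX (2026-08-27, door-c4 g13; referee V-g52-6, held copy
-- `book:harari2017-galois-cohomology-class-field-theory`): three loci cited "§16.3, Prop. 16.17" for the
-- restriction map; Prop. 16.17 (p. 272) is the cup-product/`Ext`-pairing compatibility and has no
-- restriction content — corrected to §1.5 Definition 1.33 (p. 46) and the profinite restatement §4.3 (2)
-- (p. 96).  Declarations unchanged.

noncomputable section

universe u

namespace Literature.Algebra.Homology

namespace DiscreteRep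

open CategoryTheory CategoryTheory.Limits CategoryTheory.Abelian TopRep ContRepresentation
  ContinuousCohomology

variable {k Γ : Type u} [CommRing k] [TopologicalSpace k] [Group Γ] [TopologicalSpace Γ]
  [IsTopologicalGroup Γ] [CompactSpace Γ] (U : Subgroup Γ) [CompactSpace U]
  {X : TopRep.{u} k Γ} [DiscreteTopology X.V] (hX : IsDiscrete ((forgetTop k Γ).obj X))

/-! ## §1 Restriction of the standard complex -/

/-- The inclusion `U ↪ Γ` as a continuous group homomorphism. [cite: Harari2020, §4.2] -/
abbrev inclT : U →ₜ* Γ := ⟨U.subtype, continuous_subtype_val⟩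

/-- `Res X` as a topological representation of `U` (Mathlib's `TopRep.res`). [cite: Harari2020, §4.2] -/
abbrev resTop (X : TopRep.{u} k Γ) : TopRep.{u} k U := TopRep.res (inclT U : U →* Γ) X

/-- `Res X` is still topologically discrete. [cite: Harari2020, §4.2] -/
instance discreteTopology_resTop : DiscreteTopology (resTop U X).V :=
  inferInstanceAs (DiscreteTopology X.V)

include hX in
omit [CompactSpace U] in
/-- `Res X` still has open stabilisers. [cite: Harari2020, §4.2] -/
theorem isDiscrete_resTop : IsDiscrete ((forgetTop k U).obj (resTop U X)) :=
  isDiscrete_res U (stdBase X hX)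

/-- `Res (stdBase X) = stdBase (Res X)` in `C_U`, definitionally. [cite: Harari2020, §4.3] -/
theorem resD_stdBase : (resD k U).obj (stdBase X hX) = stdBase (resTop U X) (isDiscrete_resTop U hX) :=
  rfl

/-- **The morphism `Res(std_Γ X) ⟶ std_U(Res X)` of complexes in `C_U`** (Mathlib's `resolutionMap`
along `U ↪ Γ`: a continuous map `Γ → ⋯` is restricted to `U`, iteratively). [cite: Harari2020, §4.3] -/
def stdComplexResMap :
    AcyclicResolution.mapComplex (resD k U) (stdComplex X hX) ⟶
      stdComplex (resTop U X) (isDiscrete_resTop U hX) where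
  f n := ObjectProperty.homMk (X := (resD k U).obj (stdObj X hX (n + 1)))
    (Y := stdObj (resTop U X) (isDiscrete_resTop U hX) (n + 1))
    ((forgetTop k U).map (resolutionMap (inclT U) (X := X) (Y := resTop U X) (𝟙 _) (n + 1)))
  comm' i j hij := by
    obtain rfl : i + 1 = j := hij
    rw [stdComplex_d]
    change _ = (resD k U).map ((stdComplex X hX).d i (i + 1)) ≫ _
    rw [stdComplex_d]
    refine ObjectProperty.hom_ext _ (Rep.hom_ext (DFunLike.ext _ _ fun v => ?_))
    change (TopRep.d (resTop U X) (i + 1)).hom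
        ((resolutionMap (inclT U) (𝟙 (resTop U X)) (i + 1)).hom v) =
      (resolutionMap (inclT U) (𝟙 (resTop U X)) (i + 1 + 1)).hom ((TopRep.d X (i + 1)).hom v)
    exact congrArg (fun T => TopRep.Hom.hom T v)
      (resolutionMap_comp_d (inclT U) (X := X) (Y := resTop U X) (𝟙 _) (i + 1))

/-- Components of `stdComplexResMap`, elementwise. [cite: Harari2020, §4.3] -/
@[simp]
theorem stdComplexResMap_f_apply (n : ℕ) (v : (resolutionX X (n + 1)).V) :
    ((stdComplexResMap U hX).f n).hom.hom v =
      (resolutionMap (inclT U) (X := X) (Y := resTop U X) (𝟙 _) (n + 1)).hom v := rfl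

/-- The augmentations commute: `Res η_X ≫ (res-map)⁰ = 𝟙 ≫ η_{Res X}`. [cite: Harari2020, §4.3] -/
theorem stdη_res :
    (resD k U).map (stdη X hX) ≫ (stdComplexResMap U hX).f 0 =
      𝟙 ((resD k U).obj (stdBase X hX)) ≫ stdη (resTop U X) (isDiscrete_resTop U hX) := by
  rw [Category.id_comp]
  refine ObjectProperty.hom_ext _ (Rep.hom_ext (DFunLike.ext _ _ fun v => ?_))
  change (resolutionMap (inclT U) (𝟙 (resTop U X)) (0 + 1)).hom ((TopRep.d X 0).hom v) =
    (TopRep.d (resTop U X) 0).hom v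
  have h := DFunLike.congr_fun (congrArg TopRep.Hom.hom
    (resolutionMap_comp_d (inclT U) (X := X) (Y := resTop U X) (𝟙 _) 0)) v
  exact h.symm

section Open

variable (hU : IsOpen (U : Set Γ)) [U.FiniteIndex]

-- Exactness of `Res` is supplied by the instances `preservesFiniteLimits_resD U hU`,
-- `preservesFiniteColimits_resD U hU` (they depend on the hypothesis `hU`, so are taken as arguments).
variable [PreservesFiniteLimits (resD k U)] [PreservesFiniteColimits (resD k U)]

include hU in
omit [CompactSpace U] [PreservesFiniteLimits (resD k U)] [PreservesFiniteColimits (resD k U)] in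
/-- **`Res(std_Γ X)` is `Ext_{C_U}(k, –)`-acyclic** (its terms are `Res` of coinduced modules).
[cite: Harari2020, §4.3, Remark 4.24] -/
theorem ext_triv_resD_stdComplex_X_eq_zero (n q : ℕ)
    (e : Ext (triv (k := k) (Γ := U) k)
      ((AcyclicResolution.mapComplex (resD k U) (stdComplex X hX)).X n) (q + 1)) : e = 0 :=
  haveI := discreteTopology_resolutionX X n
  ext_triv_resD_eq_zero_of_iso_coind U hU (stdObjSuccIso X hX n) q e

/-! ## §2 Compatibility with Mathlib's `cochainsMap` along `U ↪ Γ` -/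

/-- Mathlib's restriction cochain map on homogeneous cochains, pushed to `Ab`. [cite: Harari2020, §4.3] -/
abbrev cochainsAbResMap : cochainsAb X ⟶ cochainsAb (resTop U X) :=
  ((forgetAb k).mapHomologicalComplex (ComplexShape.up ℕ)).map
    (cochainsMap (inclT U) (X := X) (Y := resTop U X) (𝟙 _))

/-- The composite cochain map `Ext⁰_{C_Γ}(k, std_Γ X) → Ext⁰_{C_U}(k, Res std_Γ X) → Ext⁰_{C_U}(k, std_U Res X)`.
[cite: Harari2020, §4.3, Remark 4.24] -/
def extComplexResMap :
    AcyclicResolution.extComplex (triv (Γ := Γ) k) (stdComplex X hX) ⟶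
      AcyclicResolution.extComplex (triv (Γ := U) k) (stdComplex (resTop U X) (isDiscrete_resTop U hX)) :=
  AcyclicResolution.extComplexMapF (resD k U) (triv (Γ := Γ) k) (stdComplex X hX) ≫
    AcyclicResolution.extComplexMap (triv (Γ := U) k) (stdComplexResMap U hX)

omit [U.FiniteIndex] in
/-- **`extComplexIso` intertwines `extComplexResMap` with Mathlib's restriction of cochains.**
[cite: Harari2020, §4.3, Remark 4.24] -/
theorem extComplexIso_res :
    extComplexResMap U hX ≫ (extComplexIso (resTop U X) (isDiscrete_resTop U hX)).hom =
      (extComplexIso X hX).hom ≫ cochainsAbResMap U := by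
  refine HomologicalComplex.hom_ext _ _ fun n => ?_
  unfold extComplexResMap
  rw [HomologicalComplex.comp_f, HomologicalComplex.comp_f, HomologicalComplex.comp_f]
  ext x
  apply Subtype.ext
  have hx : Ext.addEquiv₀ (x.mapExactFunctor (resD k U)) = (resD k U).map (Ext.addEquiv₀ x) := by
    conv_lhs => rw [← Ext.mk₀_addEquiv₀_apply x]
    rw [Ext.mapExactFunctor_mk₀, ← Ext.addEquiv₀_symm_apply, AddEquiv.apply_symm_apply]
  change (Ext.addEquiv₀ (((x.mapExactFunctor (resD k U))).comp
      (Ext.mk₀ ((stdComplexResMap U hX).f n)) (add_zero 0))).hom.hom (1 : k) =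
    (resolutionMap (inclT U) (X := X) (Y := resTop U X) (𝟙 _) (n + 1)).hom
      ((Ext.addEquiv₀ x).hom.hom (1 : k))
  rw [addEquiv₀_comp_mk₀, hx]
  rfl

omit [U.FiniteIndex] in
/-- **On homology: `Hⁿ(extComplexResMap)` corresponds to Mathlib's `ContinuousCohomology.map (U ↪ Γ) (𝟙)`.**
[cite: Harari2020, §4.3, Remark 4.24] -/
theorem extComplexHomologyIso_res (n : ℕ) :
    HomologicalComplex.homologyMap (extComplexResMap U hX) n ≫
        (extComplexHomologyIso (resTop U X) (isDiscrete_resTop U hX) n).hom =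
      (extComplexHomologyIso X hX n).hom ≫
        (forgetAb k).map (ContinuousCohomology.map (inclT U) (X := X) (Y := resTop U X) (𝟙 _) n) := by
  have h1 : HomologicalComplex.homologyMap (extComplexResMap U hX) n ≫
      ((HomologicalComplex.homologyFunctor _ _ n).mapIso
        (extComplexIso (resTop U X) (isDiscrete_resTop U hX))).hom =
      ((HomologicalComplex.homologyFunctor _ _ n).mapIso (extComplexIso X hX)).hom ≫
        HomologicalComplex.homologyMap (cochainsAbResMap U (X := X)) n := by
    change HomologicalComplex.homologyMap _ n ≫ HomologicalComplex.homologyMap _ n =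
      HomologicalComplex.homologyMap _ n ≫ HomologicalComplex.homologyMap _ n
    rw [← HomologicalComplex.homologyMap_comp, ← HomologicalComplex.homologyMap_comp,
      extComplexIso_res]
  have h2 : HomologicalComplex.homologyMap (cochainsAbResMap U (X := X)) n ≫
      (((homogeneousCochains (resTop U X)).sc n).mapHomologyIso (forgetAb k)).hom =
      (((homogeneousCochains X).sc n).mapHomologyIso (forgetAb k)).hom ≫
        (forgetAb k).map (ContinuousCohomology.map (inclT U) (X := X) (Y := resTop U X) (𝟙 _) n) :=
    ShortComplex.mapHomologyIso_hom_naturality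
      ((HomologicalComplex.shortComplexFunctor _ _ n).map
        (cochainsMap (inclT U) (X := X) (Y := resTop U X) (𝟙 _))) (forgetAb k)
  change _ ≫ (_ ≫ _) = (_ ≫ _) ≫ _
  exact ((Category.assoc _ _ _).symm.trans (eq_whisker h1 _)).trans
    ((Category.assoc _ _ _).trans ((whisker_eq _ h2).trans (Category.assoc _ _ _).symm))

/-! ## §3 The comparison commutes with restriction -/

include hU in
/-- The abstract identifications `Extⁿ(k, ·) ≃+ Hⁿ(Ext⁰(k, std))` over `Γ` and over `U` are intertwined by
`Res` and `Hⁿ(extComplexResMap)`. [cite: Harari2020, §4.3, Remark 4.24][cite: Weibel1994, §2.4 Thm. 2.7.6] -/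
theorem extTrivAddEquivExtComplexHomology_res (n : ℕ) (x : Ext (triv (Γ := Γ) k) (stdBase X hX) n) :
    (HomologicalComplex.homologyMap (extComplexResMap U hX) n).hom
        (extTrivAddEquivExtComplexHomology X hX n x) =
      extTrivAddEquivExtComplexHomology (resTop U X) (isDiscrete_resTop U hX) n
        (x.mapExactFunctor (resD k U)) := by
  unfold extComplexResMap
  rw [HomologicalComplex.homologyMap_comp]
  change (HomologicalComplex.homologyMap
      (AcyclicResolution.extComplexMap (triv (Γ := U) k) (stdComplexResMap U hX)) n).hom
      ((HomologicalComplex.homologyMap (AcyclicResolution.extComplexMapF (resD k U) (triv (Γ := Γ) k)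
        (stdComplex X hX)) n).hom (extTrivAddEquivExtComplexHomology X hX n x)) = _
  -- `Res η_X`, read as the augmentation of the complex `Res(std_Γ X)` (whose degree-`0` term is
  -- `Res(std⁰)` only after unfolding `Functor.mapHomologicalComplex`), is a monomorphism
  haveI := AcyclicResolution.mono_map_augmentation (resD k U) (stdComplex X hX) (stdη X hX)
  cases n with
  | zero =>
    have hA := AcyclicResolution.extAddEquivHomologyZero_map (resD k U) (triv (Γ := Γ) k)
      (stdComplex X hX) (stdη X hX) (stdη_d X hX) (exact_stdη X hX) x
    have hB := AcyclicResolution.extAddEquivHomologyZero_naturality (triv (Γ := U) k)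
      (stdComplexResMap U hX) ((resD k U).map (stdη X hX))
      (AcyclicResolution.map_hη (resD k U) (stdComplex X hX) (stdη X hX) (stdη_d X hX))
      (AcyclicResolution.map_exact_augmentation (resD k U) (stdComplex X hX) (stdη X hX) (stdη_d X hX)
        (exact_stdη X hX))
      (stdη (resTop U X) (isDiscrete_resTop U hX)) (stdη_d (resTop U X) (isDiscrete_resTop U hX))
      (exact_stdη (resTop U X) (isDiscrete_resTop U hX)) (𝟙 _) (stdη_res U hX)
      (x.mapExactFunctor (resD k U))
    exact ((congrArg _ hA).trans hB).trans
      (congrArg (extTrivAddEquivExtComplexHomology (resTop U X) (isDiscrete_resTop U hX) 0)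
        (Ext.comp_mk₀_id _))
  | succ n =>
    have hA := AcyclicResolution.extAddEquivHomologySucc_map (resD k U) (triv (Γ := Γ) k)
      (stdComplex X hX) (stdη X hX) (stdη_d X hX) (exact_stdη X hX) (stdComplex_exactAt_succ X hX)
      (ext_triv_stdComplex_X_eq_zero X hX) (ext_triv_resD_stdComplex_X_eq_zero U hX hU) n x
    have hB := AcyclicResolution.extAddEquivHomologySucc_naturality (triv (Γ := U) k)
      (stdComplexResMap U hX) ((resD k U).map (stdη X hX))
      (AcyclicResolution.map_hη (resD k U) (stdComplex X hX) (stdη X hX) (stdη_d X hX))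
      (AcyclicResolution.map_exact_augmentation (resD k U) (stdComplex X hX) (stdη X hX) (stdη_d X hX)
        (exact_stdη X hX))
      (stdη (resTop U X) (isDiscrete_resTop U hX)) (stdη_d (resTop U X) (isDiscrete_resTop U hX))
      (exact_stdη (resTop U X) (isDiscrete_resTop U hX)) (𝟙 _) (stdη_res U hX)
      (AcyclicResolution.map_exactAt (resD k U) (stdComplex X hX) (stdComplex_exactAt_succ X hX))
      (ext_triv_resD_stdComplex_X_eq_zero U hX hU)
      (stdComplex_exactAt_succ (resTop U X) (isDiscrete_resTop U hX))
      (ext_triv_stdComplex_X_eq_zero (resTop U X) (isDiscrete_resTop U hX)) n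
      (x.mapExactFunctor (resD k U))
    exact ((congrArg _ hA).trans hB).trans
      (congrArg (extTrivAddEquivExtComplexHomology (resTop U X) (isDiscrete_resTop U hX) (n + 1))
        (Ext.comp_mk₀_id _))

include hU in
/-- **THE COMPARISON COMMUTES WITH RESTRICTION TO AN OPEN SUBGROUP.**  For `U ≤ Γ` open of finite
index and `x ∈ Extⁿ_{C_Γ}(k, X)`: `Hⁿ(res) (Φ_X x) = Φ_{Res X} (Res x)`, with `Hⁿ(res)` Mathlib's
`ContinuousCohomology.map (U ↪ Γ) (𝟙 (Res X)) : Hⁿ_cont(Γ, X) → Hⁿ_cont(U, Res X)` and `Res x` the image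
under the exact restriction functor `resD k U : C_Γ ⥤ C_U` (`Ext.mapExactFunctor`; its exactness
instances are `preservesFiniteLimits_resD U hU` / `preservesFiniteColimits_resD U hU`, to be supplied
with `haveI`). [cite: Harari2020, §4.3 (2) and Remark 4.24] -/
theorem extTrivAddEquivContinuousCohomology_res (n : ℕ) (x : Ext (triv (Γ := Γ) k) (stdBase X hX) n) :
    (ContinuousCohomology.map (inclT U) (X := X) (Y := resTop U X) (𝟙 _) n).hom
        (extTrivAddEquivContinuousCohomology X hX n x) =
      extTrivAddEquivContinuousCohomology (resTop U X) (isDiscrete_resTop U hX) n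
        (x.mapExactFunctor (resD k U)) := by
  change ((extComplexHomologyIso X hX n).hom ≫ (forgetAb k).map
      (ContinuousCohomology.map (inclT U) (X := X) (Y := resTop U X) (𝟙 _) n)).hom
      (extTrivAddEquivExtComplexHomology X hX n x) =
    (extComplexHomologyIso (resTop U X) (isDiscrete_resTop U hX) n).hom.hom
      (extTrivAddEquivExtComplexHomology (resTop U X) (isDiscrete_resTop U hX) n
        (x.mapExactFunctor (resD k U)))
  rw [← extComplexHomologyIso_res U hX, ← extTrivAddEquivExtComplexHomology_res U hX hU]
  rfl

end Open

end DiscreteRep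

end Literature.Algebra.Homology
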